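import Mathlib
import HarnessLib
import Summits.AtomisticToContinuum.Statement
import Summits.AtomisticToContinuum.Crystallization.Theses.OverbindingBudget

/-!
# `RecurrenceDividend` (route OverbindingBudget, item stmt-AtomisticToContinuum-31267) — proof

The TRUE-type law of lens 4, generation 7: a uniformly discrete, two-way uniformly recurrent point set of `ℝ³`
that is NOT gapped-twelve clean at any reference scale `a ∈ [47/50, 1]` carries **robust syndetic violators**:
one margin `t > 0` and one radius `L` such that every `L`-ball around every site contains, for every `a`, a site
failing the `t`-relaxed gapped-twelve test.  Proof = scale compactness of the window (pointwise margins are open in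
`a`; finite subcover) + recurrence transfer along the two-way matching (margin `t ↦ t/2`).  The two registered
stubs of the line `Cruxes/FragileDefectLimitWindows/Lines/birth.lean` are proved BY NAME and signature
(`stub_scaleCompactness`, `stub_recurrenceTransfer`), then the items `RecurrenceDividend` (31267),
`FragileDefectLimitWindows` (31279) and the split glue `ThinTailDefectLimitWindowsGlue` (31281) BY NAME.
-/

namespace Summit.AtomisticToContinuum.Crystallization.Theorems.OverbindingBudgetRecurrenceDividend

open Literature.MathematicalPhysics.StatisticalMechanics Metric

variable {Y : Set (EuclideanSpace ℝ (Fin 3))}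

/-! ## Finiteness of shells in a uniformly discrete set -/

/-- In a uniformly discrete set every punctured closed shell `{w ∈ Y | w ≠ y ∧ dist y w ≤ ρ}` is finite (packing:
`UniformlyDiscrete.finite_inter_closedBall`). [folklore] -/
theorem finite_shell (hUD : UniformlyDiscrete Y) (y : EuclideanSpace ℝ (Fin 3)) (ρ : ℝ) :
    {w ∈ Y | w ≠ y ∧ dist y w ≤ ρ}.Finite := by
  refine (hUD.finite_inter_closedBall y ρ).subset ?_
  intro w hw
  refine ⟨hw.1, ?_⟩
  rw [mem_closedBall, dist_comm]
  exact hw.2.2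

/-- In a uniformly discrete set every punctured open shell `{w ∈ Y | w ≠ y ∧ dist y w < ρ}` is finite. [folklore] -/
theorem finite_shell' (hUD : UniformlyDiscrete Y) (y : EuclideanSpace ℝ (Fin 3)) (ρ : ℝ) :
    {w ∈ Y | w ≠ y ∧ dist y w < ρ}.Finite := by
  refine (finite_shell hUD y ρ).subset ?_
  intro w hw
  exact ⟨hw.1, hw.2.1, hw.2.2.le⟩

/-! ## Monotonicity of the relaxed test in the margin -/

/-- The relaxed test is monotone in the margin: passing at margin `t` implies passing at any `t' ≥ t`
(finiteness of shells makes `Set.ncard` monotone). [folklore] -/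
theorem relaxedTest_mono (hUD : UniformlyDiscrete Y) {a t t' : ℝ} (htt : t ≤ t') {y : EuclideanSpace ℝ (Fin 3)}
    (h : ({w ∈ Y | w ≠ y ∧ dist y w < a * (63 / 50) - t}.ncard ≤ 12 ∧ 12 ≤ {w ∈ Y | w ≠ y ∧ dist y w ≤ a * (1 + 1 / 50) + t}.ncard ∧ ∀ w ∈ Y, w ≠ y → a * (1 - 1 / 50) - t ≤ dist y w ∧ (dist y w ≤ a * (1 + 1 / 50) + t ∨ a * (63 / 50) - t ≤ dist y w))) : ({w ∈ Y | w ≠ y ∧ dist y w < a * (63 / 50) - t'}.ncard ≤ 12 ∧ 12 ≤ {w ∈ Y | w ≠ y ∧ dist y w ≤ a * (1 + 1 / 50) + t'}.ncard ∧ ∀ w ∈ Y, w ≠ y → a * (1 - 1 / 50) - t' ≤ dist y w ∧ (dist y w ≤ a * (1 + 1 / 50) + t' ∨ a * (63 / 50) - t' ≤ dist y w)) := by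
  obtain ⟨h1, h2, h3⟩ := h
  refine ⟨?_, ?_, fun w hw hwy => ?_⟩
  · have hsub : {w ∈ Y | w ≠ y ∧ dist y w < a * (63 / 50) - t'} ⊆
        {w ∈ Y | w ≠ y ∧ dist y w < a * (63 / 50) - t} := fun w hw =>
      ⟨hw.1, hw.2.1, by linarith [hw.2.2]⟩
    exact (Set.ncard_le_ncard hsub (finite_shell' hUD y _)).trans h1
  · have hsub : {w ∈ Y | w ≠ y ∧ dist y w ≤ a * (1 + 1 / 50) + t} ⊆
        {w ∈ Y | w ≠ y ∧ dist y w ≤ a * (1 + 1 / 50) + t'} := fun w hw =>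
      ⟨hw.1, hw.2.1, by linarith [hw.2.2]⟩
    exact h2.trans (Set.ncard_le_ncard hsub (finite_shell hUD y _))
  · obtain ⟨h31, h32⟩ := h3 w hw hwy
    refine ⟨by linarith, ?_⟩
    rcases h32 with h | h
    · left; linarith
    · right; linarith

/-! ## Pointwise violations have a margin, openly in the scale -/

/-- **Pointwise margins, openly in the scale.** A site failing the exact gapped-twelve test at scale `a > 0` fails the
`t`-relaxed test at every scale `a'` with `|a' - a| < δ`, for some `t, δ > 0`: a short bond (V3) or a gap intruder (V4)
keeps its slack; otherwise the inner-shell count is `≠ 12` and either `≥ 13` points lie below the relaxed gap (V1) or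
`≤ 11` lie in the relaxed inner shell (V2), with `t = a/10`, `δ = a/100`. [folklore] -/
theorem violation_open (hUD : UniformlyDiscrete Y) {a : ℝ} (ha : 0 < a) {y : EuclideanSpace ℝ (Fin 3)}
    (hG : ¬ ({w ∈ Y | w ≠ y ∧ dist y w ≤ a * (1 + 1 / 50)}.ncard = 12 ∧ ∀ w ∈ Y, w ≠ y → a * (1 - 1 / 50) ≤ dist y w ∧ (dist y w ≤ a * (1 + 1 / 50) ∨ a * (63 / 50) ≤ dist y w))) :
    ∃ t : ℝ, 0 < t ∧ ∃ δ : ℝ, 0 < δ ∧ ∀ a' : ℝ, |a' - a| < δ → ¬ ({w ∈ Y | w ≠ y ∧ dist y w < a' * (63 / 50) - t}.ncard ≤ 12 ∧ 12 ≤ {w ∈ Y | w ≠ y ∧ dist y w ≤ a' * (1 + 1 / 50) + t}.ncard ∧ ∀ w ∈ Y, w ≠ y → a' * (1 - 1 / 50) - t ≤ dist y w ∧ (dist y w ≤ a' * (1 + 1 / 50) + t ∨ a' * (63 / 50) - t ≤ dist y w)) := by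
  by_cases h3 : ∃ w ∈ Y, w ≠ y ∧ dist y w < a * (1 - 1 / 50)
  · -- V3: a short bond
    obtain ⟨w, hw, hwy, hd⟩ := h3
    refine ⟨(a * (1 - 1 / 50) - dist y w) / 2, by linarith, (a * (1 - 1 / 50) - dist y w) / 2,
      by linarith, fun a' ha' hLG => ?_⟩
    have h1 := (hLG.2.2 w hw hwy).1
    have h' := abs_lt.1 ha'
    nlinarith [dist_nonneg (x := y) (y := w)]
  · by_cases h4 : ∃ w ∈ Y, w ≠ y ∧ a * (1 + 1 / 50) < dist y w ∧ dist y w < a * (63 / 50)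
    · -- V4: a gap intruder
      obtain ⟨w, hw, hwy, hd1, hd2⟩ := h4
      refine ⟨min ((dist y w - a * (1 + 1 / 50)) / 2) ((a * (63 / 50) - dist y w) / 2),
        lt_min (by linarith) (by linarith),
        min ((dist y w - a * (1 + 1 / 50)) / 2) ((a * (63 / 50) - dist y w) / 2) / 2,
        by positivity, fun a' ha' hLG => ?_⟩
      have h' := abs_lt.1 ha'
      have ht1 : min ((dist y w - a * (1 + 1 / 50)) / 2) ((a * (63 / 50) - dist y w) / 2) ≤
          (dist y w - a * (1 + 1 / 50)) / 2 := min_le_left _ _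
      have ht2 : min ((dist y w - a * (1 + 1 / 50)) / 2) ((a * (63 / 50) - dist y w) / 2) ≤
          (a * (63 / 50) - dist y w) / 2 := min_le_right _ _
      have ht0 : 0 < min ((dist y w - a * (1 + 1 / 50)) / 2) ((a * (63 / 50) - dist y w) / 2) :=
        lt_min (by linarith) (by linarith)
      rcases (hLG.2.2 w hw hwy).2 with h | h
      · linarith
      · linarith
    · -- no short bond, no gap intruder: the count is wrong (V1 or V2)
      push Not at h3 h4
      have hall : ∀ w ∈ Y, w ≠ y → a * (1 - 1 / 50) ≤ dist y w ∧
          (dist y w ≤ a * (1 + 1 / 50) ∨ a * (63 / 50) ≤ dist y w) := by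
        intro w hw hwy
        refine ⟨h3 w hw hwy, ?_⟩
        by_cases h5 : dist y w ≤ a * (1 + 1 / 50)
        · exact Or.inl h5
        · exact Or.inr (h4 w hw hwy (lt_of_not_ge h5))
      have hne : {w ∈ Y | w ≠ y ∧ dist y w ≤ a * (1 + 1 / 50)}.ncard ≠ 12 := fun h => hG ⟨h, hall⟩
      have hAfin := finite_shell hUD y (a * (1 + 1 / 50))
      refine ⟨a / 10, by positivity, a / 100, by positivity, fun a' ha' hLG => ?_⟩
      have h' := abs_lt.1 ha'
      rcases Nat.lt_or_gt_of_ne hne with hlt | hgt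
      · -- V2: fewer than twelve in the relaxed inner shell
        have hsub : {w ∈ Y | w ≠ y ∧ dist y w ≤ a' * (1 + 1 / 50) + a / 10} ⊆
            {w ∈ Y | w ≠ y ∧ dist y w ≤ a * (1 + 1 / 50)} := by
          intro w hw
          refine ⟨hw.1, hw.2.1, ?_⟩
          rcases (hall w hw.1 hw.2.1).2 with h | h
          · exact h
          · exfalso; linarith [hw.2.2]
        have hle := Set.ncard_le_ncard hsub hAfin
        exact absurd (hLG.2.1.trans hle) (not_le.2 hlt)
      · -- V1: at least thirteen below the relaxed gap
        have hsub : {w ∈ Y | w ≠ y ∧ dist y w ≤ a * (1 + 1 / 50)} ⊆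
            {w ∈ Y | w ≠ y ∧ dist y w < a' * (63 / 50) - a / 10} := by
          intro w hw
          exact ⟨hw.1, hw.2.1, by linarith [hw.2.2, h'.1]⟩
        have hle := Set.ncard_le_ncard hsub (finite_shell' hUD y _)
        exact absurd (hle.trans hLG.1) (not_le.2 hgt)

/-! ## Scale compactness -/

/-- **Scale compactness** (the line's first stub, internal form): if `Y` is gapped-twelve clean at no scale of the
window `[47/50, 1]`, one margin `t > 0` and finitely many witness sites serve every scale (finite subcover of the
compact window by the open scale-neighbourhoods of `violation_open`, `t` = the minimum margin). [folklore] -/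
theorem scaleCompactness (hUD : UniformlyDiscrete Y)
    (hnc : ¬ ∃ a : ℝ, 47 / 50 ≤ a ∧ a ≤ 1 ∧ ∀ y ∈ Y, ({w ∈ Y | w ≠ y ∧ dist y w ≤ a * (1 + 1 / 50)}.ncard = 12 ∧ ∀ w ∈ Y, w ≠ y → a * (1 - 1 / 50) ≤ dist y w ∧ (dist y w ≤ a * (1 + 1 / 50) ∨ a * (63 / 50) ≤ dist y w))) :
    ∃ t : ℝ, 0 < t ∧ ∃ S : Finset (EuclideanSpace ℝ (Fin 3)), (↑S : Set (EuclideanSpace ℝ (Fin 3))) ⊆ Y ∧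
      ∀ a : ℝ, 47 / 50 ≤ a → a ≤ 1 → ∃ y ∈ S, ¬ ({w ∈ Y | w ≠ y ∧ dist y w < a * (63 / 50) - t}.ncard ≤ 12 ∧ 12 ≤ {w ∈ Y | w ≠ y ∧ dist y w ≤ a * (1 + 1 / 50) + t}.ncard ∧ ∀ w ∈ Y, w ≠ y → a * (1 - 1 / 50) - t ≤ dist y w ∧ (dist y w ≤ a * (1 + 1 / 50) + t ∨ a * (63 / 50) - t ≤ dist y w)) := by
  have hpt : ∀ a ∈ Set.Icc (47 / 50 : ℝ) 1, ∃ y ∈ Y, ∃ t : ℝ, 0 < t ∧ ∃ δ : ℝ, 0 < δ ∧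
      ∀ a' : ℝ, |a' - a| < δ → ¬ ({w ∈ Y | w ≠ y ∧ dist y w < a' * (63 / 50) - t}.ncard ≤ 12 ∧ 12 ≤ {w ∈ Y | w ≠ y ∧ dist y w ≤ a' * (1 + 1 / 50) + t}.ncard ∧ ∀ w ∈ Y, w ≠ y → a' * (1 - 1 / 50) - t ≤ dist y w ∧ (dist y w ≤ a' * (1 + 1 / 50) + t ∨ a' * (63 / 50) - t ≤ dist y w)) := by
    intro a ha
    have hex : ∃ y ∈ Y, ¬ ({w ∈ Y | w ≠ y ∧ dist y w ≤ a * (1 + 1 / 50)}.ncard = 12 ∧ ∀ w ∈ Y, w ≠ y → a * (1 - 1 / 50) ≤ dist y w ∧ (dist y w ≤ a * (1 + 1 / 50) ∨ a * (63 / 50) ≤ dist y w)) := by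
      by_contra h
      push Not at h
      exact hnc ⟨a, ha.1, ha.2, h⟩
    obtain ⟨y, hy, hG⟩ := hex
    obtain ⟨t, ht, δ, hδ, h⟩ := violation_open hUD (by linarith [ha.1]) hG
    exact ⟨y, hy, t, ht, δ, hδ, h⟩
  choose! yf hyf tf htf δf hδf hv using hpt
  obtain ⟨T, hTs, hcov⟩ := (isCompact_Icc : IsCompact (Set.Icc (47 / 50 : ℝ) 1)).elim_nhds_subcover
    (fun a => ball a (δf a)) (fun a ha => ball_mem_nhds a (hδf a ha))
  have h1 : (1 : ℝ) ∈ Set.Icc (47 / 50 : ℝ) 1 := ⟨by norm_num, le_rfl⟩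
  have hTne : T.Nonempty := by
    by_contra h
    rw [Finset.not_nonempty_iff_eq_empty] at h
    have := hcov h1
    simp [h] at this
  refine ⟨T.inf' hTne tf, (Finset.lt_inf'_iff hTne).2 (fun b hb => htf b (hTs b hb)), T.image yf, ?_,
    fun a ha1 ha2 => ?_⟩
  · intro y hy
    rw [Finset.coe_image] at hy
    obtain ⟨b, hb, rfl⟩ := hy
    exact hyf b (hTs b hb)
  · have hmem := hcov ⟨ha1, ha2⟩
    rw [Set.mem_iUnion₂] at hmem
    obtain ⟨b, hb, hab⟩ := hmem
    refine ⟨yf b, Finset.mem_image_of_mem _ hb, fun hLG => ?_⟩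
    have hab' : |a - b| < δf b := by rwa [mem_ball, Real.dist_eq] at hab
    exact hv b (hTs b hb) a hab' (relaxedTest_mono hUD (Finset.inf'_le _ hb) hLG)

/-! ## Recurrence transfer -/

/-- relative positions within `ε` move centre distances by at most `ε`. -/
theorem abs_dist_sub_dist_le {p q' y y' : EuclideanSpace ℝ (Fin 3)} {ε : ℝ}
    (h : dist (y' - q') (y - p) ≤ ε) : |dist q' y' - dist p y| ≤ ε := by
  have h1 : dist q' y' = ‖y' - q'‖ := by rw [dist_comm, dist_eq_norm]
  have h2 : dist p y = ‖y - p‖ := by rw [dist_comm, dist_eq_norm]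
  rw [h1, h2]
  exact (abs_norm_sub_norm_le _ _).trans (by rwa [← dist_eq_norm])

/-- **Transfer of the relaxed test along a two-way `ε`-matching of `R`-patches** (contrapositive form: if the copy
`q'` passes the `t/2`-relaxed test then the original centre `p` passes the `t`-relaxed test; `R = t + 2` covers every
test radius, `ε ≤ t/2` absorbs the margin loss, `3ε ≤ δ` keeps matched points distinct and the matchings injective). -/
theorem relaxedTest_transfer {δ : ℝ} (hδ : 0 < δ) (hsep : ∀ x ∈ Y, ∀ y ∈ Y, x ≠ y → δ ≤ dist x y)
    {ε t a R : ℝ} (ht : 0 < t) (hεt : ε ≤ t / 2) (hεδ : 3 * ε ≤ δ) (ha1 : a ≤ 1)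
    (hR : R = t + 2) {p q' : EuclideanSpace ℝ (Fin 3)} (hp : p ∈ Y) (hq' : q' ∈ Y)
    (hfwd : ∀ y ∈ Y, dist y p ≤ R → ∃ y' ∈ Y, dist (y' - q') (y - p) ≤ ε)
    (hbwd : ∀ y' ∈ Y, dist y' q' ≤ R → ∃ y ∈ Y, dist (y' - q') (y - p) ≤ ε)
    (h : ({w ∈ Y | w ≠ q' ∧ dist q' w < a * (63 / 50) - t / 2}.ncard ≤ 12 ∧ 12 ≤ {w ∈ Y | w ≠ q' ∧ dist q' w ≤ a * (1 + 1 / 50) + t / 2}.ncard ∧ ∀ w ∈ Y, w ≠ q' → a * (1 - 1 / 50) - t / 2 ≤ dist q' w ∧ (dist q' w ≤ a * (1 + 1 / 50) + t / 2 ∨ a * (63 / 50) - t / 2 ≤ dist q' w))) : ({w ∈ Y | w ≠ p ∧ dist p w < a * (63 / 50) - t}.ncard ≤ 12 ∧ 12 ≤ {w ∈ Y | w ≠ p ∧ dist p w ≤ a * (1 + 1 / 50) + t}.ncard ∧ ∀ w ∈ Y, w ≠ p → a * (1 - 1 / 50) - t ≤ dist p w ∧ (dist p w ≤ a * (1 +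 1 / 50) + t ∨ a * (63 / 50) - t ≤ dist p w)) := by
  have hUD : UniformlyDiscrete Y := ⟨δ, hδ, hsep⟩
  have hεδ' : ε < δ := by linarith
  choose! φ hφY hφd using hfwd
  choose! ψ hψY hψd using hbwd
  obtain ⟨h1, h2, h3⟩ := h
  have hφdist : ∀ y ∈ Y, dist y p ≤ R → |dist q' (φ y) - dist p y| ≤ ε :=
    fun y hy hyR => abs_dist_sub_dist_le (hφd y hy hyR)
  have hψdist : ∀ y' ∈ Y, dist y' q' ≤ R → |dist q' y' - dist p (ψ y')| ≤ ε :=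
    fun y' hy' hyR => abs_dist_sub_dist_le (hψd y' hy' hyR)
  -- matched points stay off the centre
  have hφne : ∀ y ∈ Y, y ≠ p → dist y p ≤ R → φ y ≠ q' := by
    intro y hy hyp hyR hEq
    have hd := (abs_le.1 (hφdist y hy hyR)).1
    rw [hEq, dist_self] at hd
    have := hsep y hy p hp hyp
    rw [dist_comm] at this
    linarith
  have hψne : ∀ y' ∈ Y, y' ≠ q' → dist y' q' ≤ R → ψ y' ≠ p := by
    intro y' hy' hyq hyR hEq
    have hd := (abs_le.1 (hψdist y' hy' hyR)).2
    rw [hEq, dist_self] at hd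
    have := hsep y' hy' q' hq' hyq
    rw [dist_comm] at this
    linarith
  -- the matchings are injective on the patches
  have hφinj : ∀ y₁ ∈ Y, dist y₁ p ≤ R → ∀ y₂ ∈ Y, dist y₂ p ≤ R → φ y₁ = φ y₂ → y₁ = y₂ := by
    intro y₁ hy₁ h₁R y₂ hy₂ h₂R hEq
    by_contra hne
    have hδ12 := hsep y₁ hy₁ y₂ hy₂ hne
    have : dist y₁ y₂ ≤ ε + ε :=
      calc dist y₁ y₂ = dist (y₁ - p) (y₂ - p) := (dist_sub_right y₁ y₂ p).symm
        _ ≤ dist (y₁ - p) (φ y₁ - q') + dist (φ y₁ - q') (y₂ - p) := dist_triangle _ _ _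
        _ ≤ ε + ε := add_le_add (by rw [dist_comm]; exact hφd y₁ hy₁ h₁R)
            (by rw [hEq]; exact hφd y₂ hy₂ h₂R)
    linarith
  have hψinj : ∀ y₁ ∈ Y, dist y₁ q' ≤ R → ∀ y₂ ∈ Y, dist y₂ q' ≤ R → ψ y₁ = ψ y₂ → y₁ = y₂ := by
    intro y₁ hy₁ h₁R y₂ hy₂ h₂R hEq
    by_contra hne
    have hδ12 := hsep y₁ hy₁ y₂ hy₂ hne
    have : dist y₁ y₂ ≤ ε + ε :=
      calc dist y₁ y₂ = dist (y₁ - q') (y₂ - q') := (dist_sub_right y₁ y₂ q').symm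
        _ ≤ dist (y₁ - q') (ψ y₁ - p) + dist (ψ y₁ - p) (y₂ - q') := dist_triangle _ _ _
        _ ≤ ε + ε := add_le_add (hψd y₁ hy₁ h₁R) (by rw [hEq, dist_comm]; exact hψd y₂ hy₂ h₂R)
    linarith
  refine ⟨?_, ?_, fun w hw hwp => ?_⟩
  · -- clause 1: the short-gap shell of `p` maps injectively (φ) into that of `q'`
    refine (Set.ncard_le_ncard_of_injOn φ (fun w hw => ?_) (fun w₁ hw₁ w₂ hw₂ hEq => ?_)
      (finite_shell' hUD q' _)).trans h1
    · obtain ⟨hwY, hwp, hwd⟩ := hw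
      have hwR : dist w p ≤ R := by rw [dist_comm]; nlinarith
      refine ⟨hφY w hwY hwR, hφne w hwY hwp hwR, ?_⟩
      have := (abs_le.1 (hφdist w hwY hwR)).2
      linarith
    · exact hφinj w₁ hw₁.1 (by rw [dist_comm]; nlinarith [hw₁.2.2]) w₂ hw₂.1
        (by rw [dist_comm]; nlinarith [hw₂.2.2]) hEq
  · -- clause 2: the relaxed inner shell of `q'` maps injectively (ψ) into that of `p`
    refine h2.trans (Set.ncard_le_ncard_of_injOn ψ (fun w' hw' => ?_) (fun w₁ hw₁ w₂ hw₂ hEq => ?_)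
      (finite_shell hUD p _))
    · obtain ⟨hwY, hwq, hwd⟩ := hw'
      have hwR : dist w' q' ≤ R := by rw [dist_comm]; nlinarith
      refine ⟨hψY w' hwY hwR, hψne w' hwY hwq hwR, ?_⟩
      have := (abs_le.1 (hψdist w' hwY hwR)).1
      linarith
    · exact hψinj w₁ hw₁.1 (by rw [dist_comm]; nlinarith [hw₁.2.2]) w₂ hw₂.1
        (by rw [dist_comm]; nlinarith [hw₂.2.2]) hEq
  · -- clauses 3/4: window and gap transfer pointwise (far points are trivially beyond every radius)
    by_cases hwR : dist w p ≤ R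
    · have hφw := h3 (φ w) (hφY w hw hwR) (hφne w hw hwp hwR)
      have hd := abs_le.1 (hφdist w hw hwR)
      refine ⟨by linarith [hφw.1, hd.1, hd.2], ?_⟩
      rcases hφw.2 with hh | hh
      · left; linarith [hd.1, hd.2]
      · right; linarith [hd.1, hd.2]
    · push Not at hwR
      rw [dist_comm] at hwR
      exact ⟨by nlinarith, Or.inr (by nlinarith)⟩

/-- **Recurrence transfer** (the line's second stub, internal form): finitely many margin-`t` witnesses and two-way
uniform recurrence (patch radius `t + 2`, precision `min (t/2) (δ/3)`) put a margin-`t/2` violator within a uniform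
distance `L` of every site, for every scale of the window. [folklore] -/
theorem recurrenceTransfer (hUD : UniformlyDiscrete Y)
    (hrec : ∀ R ε : ℝ, 0 < ε → ∃ L : ℝ, ∀ p ∈ Y, ∀ q ∈ Y, ∃ q' ∈ Y, dist q' q ≤ L ∧
      (∀ y ∈ Y, dist y p ≤ R → ∃ y' ∈ Y, dist (y' - q') (y - p) ≤ ε) ∧
      (∀ y' ∈ Y, dist y' q' ≤ R → ∃ y ∈ Y, dist (y' - q') (y - p) ≤ ε))
    {t : ℝ} (ht : 0 < t) (S : Finset (EuclideanSpace ℝ (Fin 3))) (hS : (↑S : Set (EuclideanSpace ℝ (Fin 3))) ⊆ Y)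
    (hall : ∀ a : ℝ, 47 / 50 ≤ a → a ≤ 1 → ∃ y ∈ S, ¬ ({w ∈ Y | w ≠ y ∧ dist y w < a * (63 / 50) - t}.ncard ≤ 12 ∧ 12 ≤ {w ∈ Y | w ≠ y ∧ dist y w ≤ a * (1 + 1 / 50) + t}.ncard ∧ ∀ w ∈ Y, w ≠ y → a * (1 - 1 / 50) - t ≤ dist y w ∧ (dist y w ≤ a * (1 + 1 / 50) + t ∨ a * (63 / 50) - t ≤ dist y w))) :
    ∃ L : ℝ, ∀ q ∈ Y, ∀ a : ℝ, 47 / 50 ≤ a → a ≤ 1 → ∃ y ∈ Y, dist y q ≤ L ∧ ¬ ({w ∈ Y | w ≠ y ∧ dist y w < a * (63 / 50) - t / 2}.ncard ≤ 12 ∧ 12 ≤ {w ∈ Y | w ≠ y ∧ dist y w ≤ a * (1 + 1 / 50) + t / 2}.ncard ∧ ∀ w ∈ Y, w ≠ y → a * (1 - 1 / 50) - t / 2 ≤ dist y w ∧ (dist y w ≤ a * (1 + 1 / 50) + t / 2 ∨ a * (63 / 50) - t / 2 ≤ dist y w)) := by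
  obtain ⟨δ, hδ, hsep⟩ := id hUD
  obtain ⟨L, hL⟩ := hrec (t + 2) (min (t / 2) (δ / 3)) (lt_min (by linarith) (by linarith))
  refine ⟨L, fun q hq a ha1 ha2 => ?_⟩
  obtain ⟨y₀, hy₀S, hy₀⟩ := hall a ha1 ha2
  have hy₀Y : y₀ ∈ Y := hS (Finset.mem_coe.2 hy₀S)
  obtain ⟨q', hq'Y, hq'q, hfwd, hbwd⟩ := hL y₀ hy₀Y q hq
  exact ⟨q', hq'Y, hq'q, fun h => hy₀ (relaxedTest_transfer hδ hsep ht (min_le_left _ _)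
    (by linarith [min_le_right (t / 2) (δ / 3)]) ha2 rfl hy₀Y hq'Y hfwd hbwd h)⟩

/-! ## The registered stubs and the items, BY NAME -/

/-- Registered stub 1 of `Cruxes/FragileDefectLimitWindows/Lines/birth.lean` (scale compactness), verbatim signature. -/
theorem stub_scaleCompactness :
    ∀ Y : Set (EuclideanSpace ℝ (Fin 3)), Literature.MathematicalPhysics.StatisticalMechanics.UniformlyDiscrete Y → (¬ (∃ a : ℝ, 47 / 50 ≤ a ∧ a ≤ 1 ∧ ∀ y ∈ Y, ({w ∈ Y | w ≠ y ∧ dist y w ≤ a * (1 + 1 / 50)}.ncard = 12 ∧ ∀ w ∈ Y, w ≠ y → a * (1 - 1 / 50) ≤ dist y w ∧ (dist y w ≤ a * (1 + 1 / 50) ∨ a * (63 / 50) ≤ dist y w)))) → ∃ t : ℝ, 0 < t ∧ ∃ S : Finset (EuclideanSpace ℝ (Fin 3)), (↑S : Set (EuclideanSpace ℝ (Fin 3))) ⊆ Y ∧ ∀ a : ℝ, 47 / 50 ≤ a → a ≤ 1 → ∃ y ∈ S, ¬ ({w ∈ Y | w ≠ y ∧ dist y w < a * (63 / 50) - t}.ncard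 ≤ 12 ∧ 12 ≤ {w ∈ Y | w ≠ y ∧ dist y w ≤ a * (1 + 1 / 50) + t}.ncard ∧ ∀ w ∈ Y, w ≠ y → a * (1 - 1 / 50) - t ≤ dist y w ∧ (dist y w ≤ a * (1 + 1 / 50) + t ∨ a * (63 / 50) - t ≤ dist y w)) := by
  intro Y hUD hnc
  exact scaleCompactness hUD hnc

/-- Registered stub 2 of `Cruxes/FragileDefectLimitWindows/Lines/birth.lean` (recurrence transfer), verbatim signature. -/
theorem stub_recurrenceTransfer :
    ∀ Y : Set (EuclideanSpace ℝ (Fin 3)), Literature.MathematicalPhysics.StatisticalMechanics.UniformlyDiscrete Y → (∀ R ε : ℝ, 0 < ε → ∃ L : ℝ, ∀ p ∈ Y, ∀ q ∈ Y, ∃ q' ∈ Y, dist q' q ≤ L ∧ (∀ y ∈ Y, dist y p ≤ R → ∃ y' ∈ Y, dist (y' - q') (y - p) ≤ ε) ∧ (∀ y' ∈ Y, dist y' q' ≤ R → ∃ y ∈ Y, dist (y' - q') (y - p) ≤ ε)) → ∀ t : ℝ, 0 < t → ∀ S : Finset (EuclideanSpace ℝ (Fin 3)), (↑S : Set (EuclideanSpace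 ℝ (Fin 3))) ⊆ Y → (∀ a : ℝ, 47 / 50 ≤ a → a ≤ 1 → ∃ y ∈ S, ¬ ({w ∈ Y | w ≠ y ∧ dist y w < a * (63 / 50) - t}.ncard ≤ 12 ∧ 12 ≤ {w ∈ Y | w ≠ y ∧ dist y w ≤ a * (1 + 1 / 50) + t}.ncard ∧ ∀ w ∈ Y, w ≠ y → a * (1 - 1 / 50) - t ≤ dist y w ∧ (dist y w ≤ a * (1 + 1 / 50) + t ∨ a * (63 / 50) - t ≤ dist y w))) → ∃ L : ℝ, ∀ q ∈ Y, ∀ a : ℝ, 47 / 50 ≤ a → a ≤ 1 → ∃ y ∈ Y, dist y q ≤ L ∧ ¬ ({w ∈ Y | w ≠ y ∧ dist y w < a * (63 / 50) - t / 2}.ncard ≤ 12 ∧ 12 ≤ {w ∈ Y | w ≠ y ∧ dist y w ≤ a * (1 + 1 / 50) + t / 2}.ncard ∧ ∀ w ∈ Y, w ≠ y → a * (1 - 1 / 50) - t / 2 ≤ dist y w ∧ (dist y w ≤ a * (1 + 1 / 50) + t / 2 ∨ a * (63 / 50) - t / 2 ≤ dist y w)) := by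
  intro Y hUD hrec t ht S hS hall
  exact recurrenceTransfer hUD hrec ht S hS hall

/-- Item `RecurrenceDividend` (stmt-AtomisticToContinuum-31267), BY NAME. -/
theorem recurrenceDividend :
    Summit.AtomisticToContinuum.Crystallization.Theses.OverbindingBudget.RecurrenceDividend := by
  intro Y hUD hrec hgap
  obtain ⟨t, ht, S, hS, hall⟩ := stub_scaleCompactness Y hUD hgap
  obtain ⟨L, hL⟩ := stub_recurrenceTransfer Y hUD hrec t ht S hS hall
  exact ⟨L, t / 2, by positivity, hL⟩

/-- Item `FragileDefectLimitWindows` (stmt-AtomisticToContinuum-31279), BY NAME: its world (¬ROBUST under THIN's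
hypotheses) is empty by the dividend. -/
theorem fragileDefectLimitWindows :
    Summit.AtomisticToContinuum.Crystallization.Theses.OverbindingBudget.FragileDefectLimitWindows := by
  intro e hT hlb x hx Y h0 hrec hlim hUD hμ hgap hsolid haper hup hlow hacc htwo hthin hfrag
  exact absurd (recurrenceDividend Y hUD hrec hgap) hfrag

/-- The split glue `ThinTailDefectLimitWindowsGlue` (stmt-AtomisticToContinuum-31281), BY NAME: excluded middle on
ROBUST(Y). -/
theorem thinTailDefectLimitWindowsGlue :
    Summit.AtomisticToContinuum.Crystallization.Theses.OverbindingBudget.ThinTailDefectLimitWindowsGlue := by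
  intro hfrag hrob e hT hlb x hx Y h0 hrec hlim hUD hμ hgap hsolid haper hup hlow hacc htwo hthin
  by_cases hR : (∃ L t : ℝ, 0 < t ∧ ∀ q ∈ Y, ∀ a : ℝ, 47 / 50 ≤ a → a ≤ 1 → ∃ y ∈ Y, dist y q ≤ L ∧ ¬ ({w ∈ Y | w ≠ y ∧ dist y w < a * (63 / 50) - t}.ncard ≤ 12 ∧ 12 ≤ {w ∈ Y | w ≠ y ∧ dist y w ≤ a * (1 + 1 / 50) + t}.ncard ∧ ∀ w ∈ Y, w ≠ y → a * (1 - 1 / 50) - t ≤ dist y w ∧ (dist y w ≤ a * (1 + 1 / 50) + t ∨ a * (63 / 50) - t ≤ dist y w)))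
  · exact hrob e hT hlb x hx Y h0 hrec hlim hUD hμ hgap hsolid haper hup hlow hacc htwo hthin hR
  · exact hfrag e hT hlb x hx Y h0 hrec hlim hUD hμ hgap hsolid haper hup hlow hacc htwo hthin hR

end Summit.AtomisticToContinuum.Crystallization.Theorems.OverbindingBudgetRecurrenceDividend
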